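import Literature.MathematicalPhysics.KineticTheory.EvenStatTruncationBound
import Literature.MathematicalPhysics.KineticTheory.CollisionTubeWeightOscillation
import Literature.MathematicalPhysics.KineticTheory.HardSphereCrossSection
import HarnessLib

/-!
# Configuration-continuity of the Enskog rate functional at the constant mark

Topic `Literature/MathematicalPhysics/KineticTheory` — static (one-configuration) estimates for the Enskog
rate functional `e_t(z) = ∫_{𝕋³} χ(t, x) g(σ³ρ_r(z, x)) Y(σ³ρ_r(z, x)) B¹_r(z, x) dx` of
`EvenCollisionTubeFunctional` at the CONSTANT mark `Ξ ≡ 1` (Enskog's collision FREQUENCY, Chapman–Cowling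
1970 §16.2–16.4: `Θ 1 (v, w) = ∫_{S²}((w − v)·ω)₊ dω = π‖v − w‖`), as a function of the configuration `z`
(positions through the cone mollifier `b_r`, `3/(πr⁴)`-Lipschitz; velocities through the bilinear pair
functional).  They are the one-configuration half of the window / Riemann-sum reduction of the Enskog time
integral `σ³∫₀^τ e_s(Φ_s z) ds` (Cercignani–Illner–Pulvirenti 1994 App. 4.A).

* `abs_sphereMark_one_le`, `measurable_sphereMark_one` — the constant mark integrates to `π‖v − w‖`
  (Chapman–Cowling's cross-section constant), has quadratic growth and a measurable sphere integral
  (inputs of the integrability lemmas of `EvenStatTruncationBound`);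
* `abs_mollDensity_sub_mollDensity_le` — `|ρ_r(z, x) − ρ_r(z', x)| ≤ 3/(πr⁴) · (N+1)⁻¹ Σᵢ d(xᵢ, xᵢ')`;
* `pairFunctional_one_eq_sum`, `abs_pairFunctional_one_le` — `B¹_r = (N+1)⁻² Σᵢⱼ bᵢ bⱼ π‖vᵢ − vⱼ‖` and
  `|B¹_r(z, x)| ≤ 2π (3/πr³) ((N+1)⁻¹Σᵢ‖vᵢ‖) ρ_r(z, x)` (it VANISHES where the mollified density does);
* `abs_pairFunctional_one_sub_le` — the Lipschitz-type estimate of `B¹_r(z, x) − B¹_r(z', x)` by the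
  displacements `d(xᵢ, xᵢ')` (weighted by the speeds) and the velocity changes `‖vᵢ − vᵢ'‖`;
* `abs_enskogRate_one_sub_le` — the three-term splitting of `e_t(z) − e_{t'}(z')` (time modulus of `χ`,
  change of `g·Y ∘ σ³ρ_r` against `B¹_r`, change of `B¹_r`), integrated over `𝕋³`;

The real-variable lemma that makes `(g·Y)(σ³ρ) · B` uniformly continuous although `a ↦ g(a)Y(a)` is only
bounded on `[0, ∞)` and continuous on `(0, ∞)` (the discontinuity at `0` is killed by `|B¹_r| ≤ D·ρ_r`) and the
pathwise window reduction live in `EnskogRateWindowReduction.lean`.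

## References

* S. Chapman, T. G. Cowling, *The Mathematical Theory of Non-Uniform Gases*, 3rd ed. (1970), §16.2–16.4.
  [ChapmanCowling1970]
* C. Cercignani, R. Illner, M. Pulvirenti, *The Mathematical Theory of Dilute Gases* (1994), §2.2,
  App. 4.A.  [CIPDiluteGases1994]

## Not here

No dynamics and no probability: the pathwise (one-orbit) and in-probability window reductions are
separate files.
-/

noncomputable section

open MeasureTheory Set Filter Topology
open scoped ENNReal InnerProductSpace BigOperators

namespace Literature.MathematicalPhysics.KineticTheory

open Literature.Analysis.FluidPDE

/-! ## The constant mark -/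

/-- Quadratic growth of the constant mark: `|Θ 1 (v, w)| = π‖v − w‖ ≤ π + (π/2)(‖v‖² + ‖w‖²)`.
[cite: ChapmanCowling1970, §16.2] -/
theorem abs_sphereMark_one_le (v w : V3) :
    |sphereMark (fun _ => (1 : ℝ)) v w| ≤ Real.pi + Real.pi / 2 * (‖v‖ ^ 2 + ‖w‖ ^ 2) := by
  -- `Θ 1 (v, w) = π‖v − w‖` (`integral_hardSphereKernel_eq_pi_mul_norm`; problem-side twin:
  -- `Theorems.CollisionRate.sphereMark_const_one`)
  have e : sphereMark (fun _ => (1 : ℝ)) v w = Real.pi * ‖v - w‖ := by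
    unfold sphereMark
    simp only [one_mul]
    rw [integral_hardSphereKernel_eq_pi_mul_norm, norm_sub_rev]
  rw [e, abs_of_nonneg (by positivity)]
  have h1 : ‖v - w‖ ≤ ‖v‖ + ‖w‖ := norm_sub_le v w
  have h2 : ‖v‖ + ‖w‖ ≤ 1 + (‖v‖ ^ 2 + ‖w‖ ^ 2) / 2 := by
    nlinarith [sq_nonneg (‖v‖ - 1), sq_nonneg (‖w‖ - 1)]
  calc Real.pi * ‖v - w‖ ≤ Real.pi * (1 + (‖v‖ ^ 2 + ‖w‖ ^ 2) / 2) :=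
        mul_le_mul_of_nonneg_left (h1.trans h2) Real.pi_pos.le
    _ = Real.pi + Real.pi / 2 * (‖v‖ ^ 2 + ‖w‖ ^ 2) := by ring

/-- The sphere integral of the constant mark is jointly measurable in the two velocities. [folklore] -/
theorem measurable_sphereMark_one :
    Measurable fun p : V3 × V3 => sphereMark (fun _ => (1 : ℝ)) p.1 p.2 :=
  (continuous_sphereMark_uncurry continuous_const).measurable

/-! ## The mollified density -/

/-- **Displacement bound of the mollified density**: `|ρ_r(z, x) − ρ_r(z', x)| ≤ 3/(πr⁴) · (N+1)⁻¹ Σᵢ d(xᵢ, xᵢ')`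
(the cone kernel is `3/(πr⁴)`-Lipschitz in the minimal-image distance). [folklore] -/
theorem abs_mollDensity_sub_mollDensity_le {N : ℕ} {r : ℝ} (hr : 0 < r)
    (z z' : Config (N + 1) (Fin 3) T3) (y : T3) :
    |mollDensity r z y - mollDensity r z' y| ≤
      3 / (Real.pi * r ^ 4) * (((N + 1 : ℕ) : ℝ)⁻¹ * ∑ i, Torus.euclidDist (z i).1 (z' i).1) := by
  rw [mollDensity_eq_avg, mollDensity_eq_avg, ← mul_sub, ← Finset.sum_sub_distrib, abs_mul,
    abs_of_nonneg (by positivity : (0 : ℝ) ≤ ((N + 1 : ℕ) : ℝ)⁻¹), mul_left_comm, Finset.mul_sum]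
  refine mul_le_mul_of_nonneg_left ((Finset.abs_sum_le_sum_abs _ _).trans
    (Finset.sum_le_sum fun i _ => ?_)) (by positivity)
  have h := abs_coneKernel_sub_coneKernel_le hr (z i).1 (z' i).1 y y
  rwa [Torus.euclidDist_self, add_zero] at h

/-! ## The pair functional at the constant mark -/

/-- **The pair functional at the constant mark** is the explicit double sum
`B¹_r(z, x) = (N+1)⁻² Σᵢ Σⱼ b_r(xᵢ, x) b_r(xⱼ, x) π‖vᵢ − vⱼ‖`. [folklore] -/
theorem pairFunctional_one_eq_sum {N : ℕ} (r : ℝ) (z : Config (N + 1) (Fin 3) T3) (y : T3) :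
    pairFunctional r (fun _ => (1 : ℝ)) z y = ((N + 1 : ℕ) : ℝ)⁻¹ * ((N + 1 : ℕ) : ℝ)⁻¹ *
      ∑ i, ∑ j, coneKernel r (z i).1 y * coneKernel r (z j).1 y * (Real.pi * ‖(z i).2 - (z j).2‖) := by
  have e : ∀ v w : V3, sphereMark (fun _ => (1 : ℝ)) v w = Real.pi * ‖v - w‖ := fun v w => by
    unfold sphereMark
    simp only [one_mul]
    rw [integral_hardSphereKernel_eq_pi_mul_norm, norm_sub_rev]
  rw [pairFunctional_eq_double_sum]
  simp only [e]

/-- `Σᵢ Σⱼ bᵢ bⱼ (eᵢ + eⱼ) = 2 (Σᵢ bᵢ eᵢ)(Σⱼ bⱼ)`. [folklore] -/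
theorem sum_sum_mul_mul_add_eq {n : ℕ} (b e : Fin n → ℝ) :
    ∑ i, ∑ j, b i * b j * (e i + e j) = 2 * ((∑ i, b i * e i) * ∑ j, b j) := by
  have h1 : ∑ i, ∑ j, b i * b j * e i = (∑ i, b i * e i) * ∑ j, b j := by
    rw [Finset.sum_mul_sum]
    exact Finset.sum_congr rfl fun i _ => Finset.sum_congr rfl fun j _ => by ring
  have h2 : ∑ i, ∑ j, b i * b j * e j = (∑ i, b i) * ∑ j, b j * e j := by
    rw [Finset.sum_mul_sum]
    exact Finset.sum_congr rfl fun i _ => Finset.sum_congr rfl fun j _ => by ring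
  have h3 : ∑ i, ∑ j, b i * b j * (e i + e j) =
      ∑ i, ∑ j, b i * b j * e i + ∑ i, ∑ j, b i * b j * e j := by
    rw [← Finset.sum_add_distrib]
    exact Finset.sum_congr rfl fun i _ => by
      rw [← Finset.sum_add_distrib]
      exact Finset.sum_congr rfl fun j _ => by ring
  rw [h3, h1, h2]
  ring

/-- **The pair functional at the constant mark vanishes with the density**:
`|B¹_r(z, x)| ≤ 2π · (3/πr³) · ((N+1)⁻¹ Σᵢ ‖vᵢ‖) · ρ_r(z, x)` (`‖vᵢ − vⱼ‖ ≤ ‖vᵢ‖ + ‖vⱼ‖`, `bⱼ ≤ 3/(πr³)`).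
[folklore] -/
theorem abs_pairFunctional_one_le {N : ℕ} {r : ℝ} (hr : 0 < r) (z : Config (N + 1) (Fin 3) T3) (y : T3) :
    |pairFunctional r (fun _ => (1 : ℝ)) z y| ≤
      2 * Real.pi * (3 / (Real.pi * r ^ 3)) * (((N + 1 : ℕ) : ℝ)⁻¹ * ∑ i, ‖(z i).2‖) * mollDensity r z y := by
  have hb0 : ∀ i, 0 ≤ coneKernel r (z i).1 y := fun i => coneKernel_nonneg hr _ _
  have hbM : ∀ i, coneKernel r (z i).1 y ≤ 3 / (Real.pi * r ^ 3) := fun i => coneKernel_le hr _ _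
  have hn : (0 : ℝ) ≤ ((N + 1 : ℕ) : ℝ)⁻¹ := by positivity
  rw [pairFunctional_one_eq_sum, mollDensity_eq_avg, abs_mul, abs_of_nonneg (mul_nonneg hn hn),
    abs_of_nonneg (Finset.sum_nonneg fun i _ => Finset.sum_nonneg fun j _ =>
      mul_nonneg (mul_nonneg (hb0 i) (hb0 j)) (by positivity))]
  have hsum : ∑ i, ∑ j, coneKernel r (z i).1 y * coneKernel r (z j).1 y * (Real.pi * ‖(z i).2 - (z j).2‖) ≤
      Real.pi * (2 * (((3 / (Real.pi * r ^ 3)) * ∑ i, ‖(z i).2‖) * ∑ j, coneKernel r (z j).1 y)) := by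
    calc ∑ i, ∑ j, coneKernel r (z i).1 y * coneKernel r (z j).1 y * (Real.pi * ‖(z i).2 - (z j).2‖)
        ≤ ∑ i, ∑ j, coneKernel r (z i).1 y * coneKernel r (z j).1 y * (Real.pi * (‖(z i).2‖ + ‖(z j).2‖)) :=
          Finset.sum_le_sum fun i _ => Finset.sum_le_sum fun j _ =>
            mul_le_mul_of_nonneg_left (mul_le_mul_of_nonneg_left (norm_sub_le _ _) Real.pi_pos.le)
              (mul_nonneg (hb0 i) (hb0 j))
      _ = Real.pi * ∑ i, ∑ j, coneKernel r (z i).1 y * coneKernel r (z j).1 y * (‖(z i).2‖ + ‖(z j).2‖) := by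
          rw [Finset.mul_sum]
          exact Finset.sum_congr rfl fun i _ => by
            rw [Finset.mul_sum]
            exact Finset.sum_congr rfl fun j _ => by ring
      _ = Real.pi * (2 * ((∑ i, coneKernel r (z i).1 y * ‖(z i).2‖) * ∑ j, coneKernel r (z j).1 y)) := by
          rw [sum_sum_mul_mul_add_eq]
      _ ≤ Real.pi * (2 * (((3 / (Real.pi * r ^ 3)) * ∑ i, ‖(z i).2‖) * ∑ j, coneKernel r (z j).1 y)) := by
          have hbe : ∑ i, coneKernel r (z i).1 y * ‖(z i).2‖ ≤ 3 / (Real.pi * r ^ 3) * ∑ i, ‖(z i).2‖ := by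
            rw [Finset.mul_sum]
            exact Finset.sum_le_sum fun i _ => mul_le_mul_of_nonneg_right (hbM i) (norm_nonneg _)
          exact mul_le_mul_of_nonneg_left (mul_le_mul_of_nonneg_left
            (mul_le_mul_of_nonneg_right hbe (Finset.sum_nonneg fun j _ => hb0 j)) zero_le_two)
            Real.pi_pos.le
  calc ((N + 1 : ℕ) : ℝ)⁻¹ * ((N + 1 : ℕ) : ℝ)⁻¹ *
        ∑ i, ∑ j, coneKernel r (z i).1 y * coneKernel r (z j).1 y * (Real.pi * ‖(z i).2 - (z j).2‖)
      ≤ ((N + 1 : ℕ) : ℝ)⁻¹ * ((N + 1 : ℕ) : ℝ)⁻¹ *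
          (Real.pi * (2 * (((3 / (Real.pi * r ^ 3)) * ∑ i, ‖(z i).2‖) * ∑ j, coneKernel r (z j).1 y))) :=
        mul_le_mul_of_nonneg_left hsum (mul_nonneg hn hn)
    _ = _ := by ring

/-- `Σᵢ Σⱼ (dᵢ + dⱼ)(eᵢ + eⱼ) = 2n Σᵢ dᵢ eᵢ + 2 (Σᵢ dᵢ)(Σⱼ eⱼ)`. [folklore] -/
theorem sum_sum_add_mul_add_eq {n : ℕ} (d e : Fin n → ℝ) :
    ∑ i, ∑ j, (d i + d j) * (e i + e j) = 2 * n * ∑ i, d i * e i + 2 * ((∑ i, d i) * ∑ j, e j) := by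
  have h1 : ∑ i, ∑ j, (d i * e i + d j * e j) = 2 * n * ∑ i, d i * e i := sum_sum_add_eq _
  have h2 : ∑ i, ∑ j, d i * e j = (∑ i, d i) * ∑ j, e j := by rw [Finset.sum_mul_sum]
  have h3 : ∑ i, ∑ j, d j * e i = (∑ i, e i) * ∑ j, d j := by
    rw [Finset.sum_mul_sum]
    exact Finset.sum_congr rfl fun i _ => Finset.sum_congr rfl fun j _ => by ring
  have h4 : ∑ i, ∑ j, (d i + d j) * (e i + e j) =
      ∑ i, ∑ j, (d i * e i + d j * e j) + (∑ i, ∑ j, d i * e j + ∑ i, ∑ j, d j * e i) := by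
    rw [← Finset.sum_add_distrib, ← Finset.sum_add_distrib]
    exact Finset.sum_congr rfl fun i _ => by
      rw [← Finset.sum_add_distrib, ← Finset.sum_add_distrib]
      exact Finset.sum_congr rfl fun j _ => by ring
  rw [h4, h1, h2, h3]
  ring

/-- Termwise estimate behind `abs_pairFunctional_one_sub_le`. [folklore] -/
theorem abs_mul_mul_norm_sub_le {b₁ b₂ b₁' b₂' L M d₁ d₂ : ℝ} {v₁ v₂ v₁' v₂' : V3}
    (hb₁ : |b₁ - b₁'| ≤ L * d₁) (hb₂ : |b₂ - b₂'| ≤ L * d₂)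
    (h₂ : 0 ≤ b₂) (h₂M : b₂ ≤ M) (h₁' : 0 ≤ b₁') (h₁'M : b₁' ≤ M) (h₂' : 0 ≤ b₂') (h₂'M : b₂' ≤ M) :
    |b₁ * b₂ * ‖v₁ - v₂‖ - b₁' * b₂' * ‖v₁' - v₂'‖| ≤
      L * M * ((d₁ + d₂) * (‖v₁‖ + ‖v₂‖)) + M ^ 2 * (‖v₁ - v₁'‖ + ‖v₂ - v₂'‖) := by
  have hL₁ : 0 ≤ L * d₁ := (abs_nonneg _).trans hb₁
  have hL₂ : 0 ≤ L * d₂ := (abs_nonneg _).trans hb₂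
  have hA : ‖v₁ - v₂‖ ≤ ‖v₁‖ + ‖v₂‖ := norm_sub_le _ _
  have hAA : |‖v₁ - v₂‖ - ‖v₁' - v₂'‖| ≤ ‖v₁ - v₁'‖ + ‖v₂ - v₂'‖ := by
    refine (abs_norm_sub_norm_le _ _).trans ?_
    rw [show v₁ - v₂ - (v₁' - v₂') = (v₁ - v₁') - (v₂ - v₂') by abel]
    exact norm_sub_le _ _
  have e : b₁ * b₂ * ‖v₁ - v₂‖ - b₁' * b₂' * ‖v₁' - v₂'‖ =
      (b₁ - b₁') * b₂ * ‖v₁ - v₂‖ + b₁' * (b₂ - b₂') * ‖v₁ - v₂‖ +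
        b₁' * b₂' * (‖v₁ - v₂‖ - ‖v₁' - v₂'‖) := by ring
  rw [e]
  refine (abs_add_three _ _ _).trans ?_
  rw [abs_mul, abs_mul, abs_mul, abs_mul, abs_mul, abs_mul, abs_of_nonneg h₂, abs_of_nonneg h₁',
    abs_of_nonneg h₂', abs_of_nonneg (norm_nonneg _)]
  have t1 : |b₁ - b₁'| * b₂ * ‖v₁ - v₂‖ ≤ L * d₁ * M * (‖v₁‖ + ‖v₂‖) :=
    mul_le_mul (mul_le_mul hb₁ h₂M h₂ hL₁) hA (norm_nonneg _) (mul_nonneg hL₁ (h₂.trans h₂M))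
  have t2 : b₁' * |b₂ - b₂'| * ‖v₁ - v₂‖ ≤ M * (L * d₂) * (‖v₁‖ + ‖v₂‖) :=
    mul_le_mul (mul_le_mul h₁'M hb₂ (abs_nonneg _) (h₁'.trans h₁'M)) hA (norm_nonneg _)
      (mul_nonneg (h₁'.trans h₁'M) hL₂)
  have t3 : b₁' * b₂' * |‖v₁ - v₂‖ - ‖v₁' - v₂'‖| ≤ M * M * (‖v₁ - v₁'‖ + ‖v₂ - v₂'‖) :=
    mul_le_mul (mul_le_mul h₁'M h₂'M h₂' (h₁'.trans h₁'M)) hAA (abs_nonneg _)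
      (mul_nonneg (h₁'.trans h₁'M) (h₂'.trans h₂'M))
  calc |b₁ - b₁'| * b₂ * ‖v₁ - v₂‖ + b₁' * |b₂ - b₂'| * ‖v₁ - v₂‖ +
        b₁' * b₂' * |‖v₁ - v₂‖ - ‖v₁' - v₂'‖|
      ≤ L * d₁ * M * (‖v₁‖ + ‖v₂‖) + M * (L * d₂) * (‖v₁‖ + ‖v₂‖) + M * M * (‖v₁ - v₁'‖ + ‖v₂ - v₂'‖) :=
        add_le_add (add_le_add t1 t2) t3
    _ = _ := by ring

/-- **Lipschitz-type estimate of the pair functional at the constant mark in the configuration.**  With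
`dᵢ = d(xᵢ, xᵢ')` (minimal-image displacement of particle `i` between `z` and `z'`), `M = 3/(πr³)`,
`L = 3/(πr⁴)`:
`|B¹_r(z,x) − B¹_r(z',x)| ≤ π (N+1)⁻² { L M (2(N+1) Σᵢ dᵢ‖vᵢ‖ + 2 (Σᵢ dᵢ)(Σⱼ ‖vⱼ‖)) + M² · 2(N+1) Σᵢ ‖vᵢ − vᵢ'‖ }`
(velocities `v` of `z`, `v'` of `z'`). [folklore] -/
theorem abs_pairFunctional_one_sub_le {N : ℕ} {r : ℝ} (hr : 0 < r) (z z' : Config (N + 1) (Fin 3) T3)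
    (y : T3) :
    |pairFunctional r (fun _ => (1 : ℝ)) z y - pairFunctional r (fun _ => (1 : ℝ)) z' y| ≤
      Real.pi * (((N + 1 : ℕ) : ℝ)⁻¹ * ((N + 1 : ℕ) : ℝ)⁻¹) *
        (3 / (Real.pi * r ^ 4) * (3 / (Real.pi * r ^ 3)) *
            (2 * (N + 1 : ℕ) * ∑ i, Torus.euclidDist (z i).1 (z' i).1 * ‖(z i).2‖ +
              2 * ((∑ i, Torus.euclidDist (z i).1 (z' i).1) * ∑ j, ‖(z j).2‖)) +
          (3 / (Real.pi * r ^ 3)) ^ 2 * (2 * (N + 1 : ℕ) * ∑ i, ‖(z i).2 - (z' i).2‖)) := by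
  have hb0 : ∀ w : Config (N + 1) (Fin 3) T3, ∀ i, 0 ≤ coneKernel r (w i).1 y :=
    fun w i => coneKernel_nonneg hr _ _
  have hbM : ∀ w : Config (N + 1) (Fin 3) T3, ∀ i, coneKernel r (w i).1 y ≤ 3 / (Real.pi * r ^ 3) :=
    fun w i => coneKernel_le hr _ _
  have hbd : ∀ i, |coneKernel r (z i).1 y - coneKernel r (z' i).1 y| ≤
      3 / (Real.pi * r ^ 4) * Torus.euclidDist (z i).1 (z' i).1 := by
    intro i
    have h := abs_coneKernel_sub_coneKernel_le hr (z i).1 (z' i).1 y y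
    rwa [Torus.euclidDist_self, add_zero] at h
  have hn : (0 : ℝ) ≤ ((N + 1 : ℕ) : ℝ)⁻¹ := by positivity
  have hpull : ∀ w : Config (N + 1) (Fin 3) T3,
      ∑ i, ∑ j, coneKernel r (w i).1 y * coneKernel r (w j).1 y * (Real.pi * ‖(w i).2 - (w j).2‖) =
        Real.pi * ∑ i, ∑ j, coneKernel r (w i).1 y * coneKernel r (w j).1 y * ‖(w i).2 - (w j).2‖ := by
    intro w
    rw [Finset.mul_sum]
    exact Finset.sum_congr rfl fun i _ => by
      rw [Finset.mul_sum]
      exact Finset.sum_congr rfl fun j _ => by ring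
  have key : |∑ i, ∑ j, coneKernel r (z i).1 y * coneKernel r (z j).1 y * ‖(z i).2 - (z j).2‖ -
      ∑ i, ∑ j, coneKernel r (z' i).1 y * coneKernel r (z' j).1 y * ‖(z' i).2 - (z' j).2‖| ≤
      3 / (Real.pi * r ^ 4) * (3 / (Real.pi * r ^ 3)) *
          (2 * (N + 1 : ℕ) * ∑ i, Torus.euclidDist (z i).1 (z' i).1 * ‖(z i).2‖ +
            2 * ((∑ i, Torus.euclidDist (z i).1 (z' i).1) * ∑ j, ‖(z j).2‖)) +
        (3 / (Real.pi * r ^ 3)) ^ 2 * (2 * (N + 1 : ℕ) * ∑ i, ‖(z i).2 - (z' i).2‖) := by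
    rw [← Finset.sum_sub_distrib]
    calc |∑ i, (∑ j, coneKernel r (z i).1 y * coneKernel r (z j).1 y * ‖(z i).2 - (z j).2‖ -
          ∑ j, coneKernel r (z' i).1 y * coneKernel r (z' j).1 y * ‖(z' i).2 - (z' j).2‖)|
        ≤ ∑ i, |∑ j, coneKernel r (z i).1 y * coneKernel r (z j).1 y * ‖(z i).2 - (z j).2‖ -
            ∑ j, coneKernel r (z' i).1 y * coneKernel r (z' j).1 y * ‖(z' i).2 - (z' j).2‖| :=
          Finset.abs_sum_le_sum_abs _ _
      _ ≤ ∑ i, ∑ j, |coneKernel r (z i).1 y * coneKernel r (z j).1 y * ‖(z i).2 - (z j).2‖ -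
            coneKernel r (z' i).1 y * coneKernel r (z' j).1 y * ‖(z' i).2 - (z' j).2‖| :=
          Finset.sum_le_sum fun i _ => by
            rw [← Finset.sum_sub_distrib]
            exact Finset.abs_sum_le_sum_abs _ _
      _ ≤ ∑ i, ∑ j, (3 / (Real.pi * r ^ 4) * (3 / (Real.pi * r ^ 3)) *
            ((Torus.euclidDist (z i).1 (z' i).1 + Torus.euclidDist (z j).1 (z' j).1) * (‖(z i).2‖ + ‖(z j).2‖)) +
            (3 / (Real.pi * r ^ 3)) ^ 2 * (‖(z i).2 - (z' i).2‖ + ‖(z j).2 - (z' j).2‖)) :=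
          Finset.sum_le_sum fun i _ => Finset.sum_le_sum fun j _ =>
            abs_mul_mul_norm_sub_le (hbd i) (hbd j) (hb0 z j) (hbM z j) (hb0 z' i) (hbM z' i)
              (hb0 z' j) (hbM z' j)
      _ = _ := by
          have hsplit : ∀ (P Q : Fin (N + 1) → Fin (N + 1) → ℝ),
              ∑ i, ∑ j, (P i j + Q i j) = ∑ i, ∑ j, P i j + ∑ i, ∑ j, Q i j := fun P Q => by
            rw [← Finset.sum_add_distrib]
            exact Finset.sum_congr rfl fun i _ => Finset.sum_add_distrib
          have hmul : ∀ (c : ℝ) (P : Fin (N + 1) → Fin (N + 1) → ℝ),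
              ∑ i, ∑ j, c * P i j = c * ∑ i, ∑ j, P i j := fun c P => by
            rw [Finset.mul_sum]
            exact Finset.sum_congr rfl fun i _ => by rw [Finset.mul_sum]
          rw [hsplit, hmul, hmul, sum_sum_add_mul_add_eq, sum_sum_add_eq]
  rw [pairFunctional_one_eq_sum, pairFunctional_one_eq_sum, hpull, hpull, ← mul_sub, ← mul_sub, abs_mul,
    abs_of_nonneg (mul_nonneg hn hn), abs_mul, abs_of_nonneg Real.pi_pos.le]
  calc ((N + 1 : ℕ) : ℝ)⁻¹ * ((N + 1 : ℕ) : ℝ)⁻¹ * (Real.pi *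
        |∑ i, ∑ j, coneKernel r (z i).1 y * coneKernel r (z j).1 y * ‖(z i).2 - (z j).2‖ -
          ∑ i, ∑ j, coneKernel r (z' i).1 y * coneKernel r (z' j).1 y * ‖(z' i).2 - (z' j).2‖|)
      ≤ ((N + 1 : ℕ) : ℝ)⁻¹ * ((N + 1 : ℕ) : ℝ)⁻¹ * (Real.pi *
          (3 / (Real.pi * r ^ 4) * (3 / (Real.pi * r ^ 3)) *
              (2 * (N + 1 : ℕ) * ∑ i, Torus.euclidDist (z i).1 (z' i).1 * ‖(z i).2‖ +
                2 * ((∑ i, Torus.euclidDist (z i).1 (z' i).1) * ∑ j, ‖(z j).2‖)) +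
            (3 / (Real.pi * r ^ 3)) ^ 2 * (2 * (N + 1 : ℕ) * ∑ i, ‖(z i).2 - (z' i).2‖))) :=
        mul_le_mul_of_nonneg_left (mul_le_mul_of_nonneg_left key Real.pi_pos.le) (mul_nonneg hn hn)
    _ = _ := by ring

/-! ## The Enskog rate functional at the constant mark -/

/-- **Three-term splitting of the Enskog rate functional at the constant mark.**  For continuous `χ, g`,
`σ ≥ 0`, `r > 0`, two time labels `t, t'` and two configurations `z, z'`: if `|χ(t', ·)| ≤ C_χ`,
`|χ(t, ·) − χ(t', ·)| ≤ ω`, `|g·Y| ≤ C_G` on `[0, ∞)`, `|B¹_r(z, ·)| ≤ M_B`, and pointwise in `x`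
`|(g·Y)(σ³ρ_r(z,x)) − (g·Y)(σ³ρ_r(z',x))| · |B¹_r(z,x)| ≤ q₁`, `|B¹_r(z,x) − B¹_r(z',x)| ≤ q₂`, then
`|e_t(z) − e_{t'}(z')| ≤ ω C_G M_B + C_χ q₁ + C_χ C_G q₂` (`vol 𝕋³ = 1`). [folklore] -/
theorem abs_enskogRate_one_sub_le {σ : ℝ} {N : ℕ} {χ : ℝ × UnitAddTorus (Fin 3) → ℝ} {g : ℝ → ℝ}
    (hχ : Continuous χ) (hg : Continuous g) (hσ : 0 ≤ σ) {r : ℝ} (hr : 0 < r) {t t' : ℝ}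
    {z z' : Config (N + 1) (Fin 3) T3} {Cχ CG ω MB q₁ q₂ : ℝ}
    (hχb : ∀ y, |χ (t', y)| ≤ Cχ) (hω : ∀ y, |χ (t, y) - χ (t', y)| ≤ ω)
    (hGb : ∀ a, 0 ≤ a → |g a * contactValue a| ≤ CG)
    (hMB : ∀ y, |pairFunctional r (fun _ => (1 : ℝ)) z y| ≤ MB)
    (hq₁ : ∀ y, |g (σ ^ 3 * mollDensity r z y) * contactValue (σ ^ 3 * mollDensity r z y) -
        g (σ ^ 3 * mollDensity r z' y) * contactValue (σ ^ 3 * mollDensity r z' y)| *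
      |pairFunctional r (fun _ => (1 : ℝ)) z y| ≤ q₁)
    (hq₂ : ∀ y, |pairFunctional r (fun _ => (1 : ℝ)) z y - pairFunctional r (fun _ => (1 : ℝ)) z' y| ≤ q₂) :
    |enskogRate σ N χ g (fun _ => (1 : ℝ)) r t z - enskogRate σ N χ g (fun _ => (1 : ℝ)) r t' z'| ≤
      ω * CG * MB + Cχ * q₁ + Cχ * CG * q₂ := by
  have hCχ0 : 0 ≤ Cχ := (abs_nonneg _).trans (hχb 0)
  have hCG0 : 0 ≤ CG := (abs_nonneg _).trans (hGb 0 le_rfl)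
  unfold enskogRate
  rw [← integral_sub
    (integrable_enskogIntegrand hχ hg hGb hσ hr measurable_sphereMark_one abs_sphereMark_one_le t z)
    (integrable_enskogIntegrand hχ hg hGb hσ hr measurable_sphereMark_one abs_sphereMark_one_le t' z')]
  have hb : ∀ y : UnitAddTorus (Fin 3),
      ‖χ (t, y) * g (σ ^ 3 * mollDensity r z y) * contactValue (σ ^ 3 * mollDensity r z y) *
          pairFunctional r (fun _ => (1 : ℝ)) z y -
        χ (t', y) * g (σ ^ 3 * mollDensity r z' y) * contactValue (σ ^ 3 * mollDensity r z' y) *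
          pairFunctional r (fun _ => (1 : ℝ)) z' y‖ ≤ ω * CG * MB + Cχ * q₁ + Cχ * CG * q₂ := by
    intro y
    have hGz : |g (σ ^ 3 * mollDensity r z y) * contactValue (σ ^ 3 * mollDensity r z y)| ≤ CG :=
      hGb _ (mul_nonneg (pow_nonneg hσ 3) (mollDensity_nonneg_of_pos hr z y))
    have hGz' : |g (σ ^ 3 * mollDensity r z' y) * contactValue (σ ^ 3 * mollDensity r z' y)| ≤ CG :=
      hGb _ (mul_nonneg (pow_nonneg hσ 3) (mollDensity_nonneg_of_pos hr z' y))
    have hω0 : 0 ≤ ω := (abs_nonneg _).trans (hω y)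
    have e : χ (t, y) * g (σ ^ 3 * mollDensity r z y) * contactValue (σ ^ 3 * mollDensity r z y) *
          pairFunctional r (fun _ => (1 : ℝ)) z y -
        χ (t', y) * g (σ ^ 3 * mollDensity r z' y) * contactValue (σ ^ 3 * mollDensity r z' y) *
          pairFunctional r (fun _ => (1 : ℝ)) z' y =
        (χ (t, y) - χ (t', y)) * (g (σ ^ 3 * mollDensity r z y) * contactValue (σ ^ 3 * mollDensity r z y)) *
            pairFunctional r (fun _ => (1 : ℝ)) z y +
          χ (t', y) * ((g (σ ^ 3 * mollDensity r z y) * contactValue (σ ^ 3 * mollDensity r z y) -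
              g (σ ^ 3 * mollDensity r z' y) * contactValue (σ ^ 3 * mollDensity r z' y)) *
            pairFunctional r (fun _ => (1 : ℝ)) z y) +
          χ (t', y) * (g (σ ^ 3 * mollDensity r z' y) * contactValue (σ ^ 3 * mollDensity r z' y)) *
            (pairFunctional r (fun _ => (1 : ℝ)) z y - pairFunctional r (fun _ => (1 : ℝ)) z' y) := by
      ring
    rw [Real.norm_eq_abs, e]
    refine (abs_add_three _ _ _).trans (add_le_add (add_le_add ?_ ?_) ?_)
    · rw [abs_mul, abs_mul]
      exact mul_le_mul (mul_le_mul (hω y) hGz (abs_nonneg _) hω0) (hMB y) (abs_nonneg _)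
        (mul_nonneg hω0 hCG0)
    · rw [abs_mul, abs_mul]
      exact mul_le_mul (hχb y) (hq₁ y) (mul_nonneg (abs_nonneg _) (abs_nonneg _)) hCχ0
    · rw [abs_mul, abs_mul]
      exact mul_le_mul (mul_le_mul (hχb y) hGz' (abs_nonneg _) hCχ0) (hq₂ y) (abs_nonneg _)
        (mul_nonneg hCχ0 hCG0)
  have h := norm_integral_le_of_norm_le_const (μ := volume) (ae_of_all _ hb)
  rwa [Real.norm_eq_abs, show (volume : Measure (UnitAddTorus (Fin 3))).real univ = 1 from probReal_univ,
    mul_one] at h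

end Literature.MathematicalPhysics.KineticTheory

end
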